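import Literature.Probability.RandomPlanarGeometry.DiscApproximation
import Literature.Probability.RandomPlanarGeometry.LSW2004USTProofs
import Literature.Probability.RandomPlanarGeometry.LSW2004USTPeanoExistence
import HarnessLib

/-!
# [LSW04] Thm. 4.7 (SLE₈ is generated by a curve) from Thm. 4.4 and Prop. 4.5 alone

G. F. Lawler, O. Schramm, W. Werner, *Conformal invariance of planar loop-erased random walks and
uniform spanning trees*, Ann. Probab. **32** (2004) 939–995 (**[LSW04]**), proof of Thm. 4.7,
p. 981. Proof-only file (no definitions, no named facts). The tree's reduction
`USTPeano.hasSLETrace_eight_of_LSW_facts` (`DiscApproximation.lean`) derives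
`Literature.Probability.RandomPlanarGeometry.hasSLETrace_eight` from the inputs of
`LSW2004UST.lean` (three named facts and Prop. 4.5 as an explicit hypothesis); two of the facts
are now theorems — `USTPeano.nonempty_peanoPath_holds` (§4.1, `LSW2004USTPeanoExistence.lean`)
and `USTPeano.exists_capacityImage_holds` (§2.1 / Thm. 4.4 set-up, `LSW2004USTProofs.lean`) — so
that exactly the two probabilistic inputs of p. 981 remain:

* `USTPeano.hasSLETrace_eight_of_prop45_of_drivingProcess_tendsto` —
  **`(Prop. 4.5) → drivingProcess_tendsto → hasSLETrace_eight`** ("the family of laws of `γ̂` is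
  tight, because of Proposition 4.5 … Theorem 4.4 implies that the law of `W` converges weakly to
  the law of `B(8t)`. Hence …"); Prop. 4.5 (p. 977) is the explicit hypothesis `h45`, its printed
  statement spelled out exactly as in `USTPeano.hasSLETrace_eight_of_LSW` (D-0026: an XL
  published estimate used only in this glue is part of the proof obligation of
  `hasSLETrace_eight`, not a separately vendored named fact; likewise the printed wording of
  Thm. 4.7 — `gₜ⁻¹` extends continuously to `ℍ̄`, `γ(t) = gₜ⁻¹(B(8t))` is continuous and
  `gₜ⁻¹(ℍ)` is the unbounded component of `ℍ ∖ γ[0, t]` — is the same proposition as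
  `hasSLETrace_eight`, `LawlerSchrammWerner2004_thm47_iff_hasSLETrace_eight`, `SLETraceEight.lean`);
* `USTPeano.isProbabilityMeasure_ustLaw'` — the UST Peano law of every `D ∈ 𝔇*` is a
  probability measure (from `nonempty_peanoPath_holds`).

## References

* G. F. Lawler, O. Schramm, W. Werner (2004), Thm. 4.4, Prop. 4.5, Thm. 4.7 (proof, p. 981)
  [LawlerSchrammWerner2004].
-/

noncomputable section

open MeasureTheory
open UpperHalfPlane (upperHalfPlaneSet)
open scoped NNReal

namespace Literature.Probability.RandomPlanarGeometry

namespace USTPeano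

/-- **The UST Peano law is a probability measure** for every `D = D(α, β, a, b) ∈ 𝔇*`
(unconditionally, now that `nonempty_peanoPath` is proved). [cite: LawlerSchrammWerner2004, §4.1] -/
theorem isProbabilityMeasure_ustLaw' (Δ : Domain) : IsProbabilityMeasure (ustLaw Δ) :=
  haveI : Nonempty (PeanoPath Δ) := nonempty_peanoPath_holds Δ
  inferInstance

/-- **[LSW04] Thm. 4.7 from Prop. 4.5 and Thm. 4.4 (as used on p. 981) alone**: with the
existence of Peano paths (§4.1) and of the capacity parametrisation (§2.1) proved in the tree,
`hasSLETrace_eight` follows from the two remaining probabilistic inputs — **Prop. 4.5** (p. 977: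
"For every `ε > 0` and `t̄ > 0` there are some positive `R₀ = R₀(D, t̄, ε)` and `δ = δ(D, t̄, ε)`
such that for all `R > R₀`, `P[sup{|γ̂(t₂) - γ̂(t₁)| : t₁, t₂ ∈ [0, t̄], |t₂ - t₁| ≤ δ} > ε] < ε`",
the explicit hypothesis `h45`, spelled out as in `hasSLETrace_eight_of_LSW`) and the named fact
`USTPeano.drivingProcess_tendsto` — through `hasSLETrace_eight_of_LSW_facts` (grid approximations
of the unit disc, Prokhorov, Lemma 3.14, identification of the limit).
[cite: LawlerSchrammWerner2004, Thm. 4.7] -/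
theorem hasSLETrace_eight_of_prop45_of_drivingProcess_tendsto
    (h45 : ∀ (D : SmoothDomain) (ε t : ℝ), 0 < ε → 0 < t →
      ∃ R₀ δ : ℝ, 0 < δ ∧ ∀ (R : ℝ) (Δ : Domain), R₀ < R → IsApproximation D R Δ →
        ∀ (φ : ConformalEquiv upperHalfPlaneSet Δ.carrier), Δ.IsLSWMap φ →
          ∀ (Γ : PeanoPath Δ → C(ℝ≥0, ℂ)) (W : PeanoPath Δ → C(ℝ≥0, ℝ)),
            (∀ γ, IsCapacityImage Δ φ γ (Γ γ) (W γ)) →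
              ustLaw Δ {γ | ∃ t₁ t₂ : ℝ≥0, (t₁ : ℝ) ≤ t ∧ (t₂ : ℝ) ≤ t ∧
                dist t₁ t₂ ≤ δ ∧ ε < dist (Γ γ t₁) (Γ γ t₂)} < ENNReal.ofReal ε)
    (h44 : drivingProcess_tendsto) : hasSLETrace_eight :=
  hasSLETrace_eight_of_LSW_facts nonempty_peanoPath_holds exists_capacityImage_holds h45 h44

end USTPeano

end Literature.Probability.RandomPlanarGeometry
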